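import Summits.BirchSwinnertonDyer.Rank1Residual.GaloisImage.PropagatedConditionLevels
import Summits.BirchSwinnertonDyer.Rank1Residual.GaloisImage.LocalH1TorsionBounded
import Literature.NumberTheory.EllipticCurves.CongruenceVisibilityLocalFactors
import Literature.NumberTheory.GaloisRepresentations.RatPlaceTwoProofs
import HarnessLib

/-!
# Orders in `X = H¹(ℚ_v, E(ℚ̄_v))` from Tate's local Euler–Poincaré characteristic: `#X[p^k]`, the
# subgroups `D_N = p^N • X[p^{N+1}]` and their stabilisation at `#D_N = #(𝓞_v/p)` — the counting
# half of row T-Lp (= DISCHARGE of the located local gap (Lp) of the N11 hypothesis side)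
# (cell `b2b-bsdres`, team n1011; seat n1011-p04 gen 5; skeleton `cells/n1011/skel/T-Lp.md` S5–S6)

HONEST FRAMING (cell `b2b-bsdres`, run/shared/lean/b2b/bsd-rank1-residual/, verbatim in every
file): the goal of the cell is to DELETE the COMBINATION-SHAPED residual classes of the
Birch–Swinnerton-Dyer formula for ALL analytic-rank `≤ 1` elliptic curves over `ℚ` — "full BSD
formula for every rank `≤ 1` curve in class `C`" assembled STRICTLY from published theorems — so
that the rank-`≤ 1` remainder becomes exactly the CONSTRUCTION-SHAPED classes, which are TYPED
(missing-input `Prop`s), NOT attempted. This is not "finishing BSD". Team n1011 (X4 ∧ `p = 3`,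
§I N11; row T-a3-F1 = the hypothesis side of Sakamoto 2024 Thm. 4.4 for `(E[3^{k+1}], 𝓕_can)`):
research route; theorems only; no definition, no named fact, no `sorry`; nothing booked; no label
changes.

## What

n1011-p13's core-rank theorem `hasCoreRank_one_propagatedSelmerStructureOne` (`χ(𝓕̄_can) = 1`,
hypothesis of Sakamoto Thm. 4.4) and the level-one N11 instance
(`SakamotoN11InstanceLevelOneInputs.lean`) carry ONE located local gap, in referee-1's print shape
(ruling (Lp) 2026-08-21): `hLpIm : #im(H¹(ℚ₃, T₃E) → H¹(ℚ₃, E[3])) = 9 · #E(ℚ₃)[3]` (Greenberg,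
LNM 1716 §2; Milne *ADT* I 3.2/3.3).  This file PROVES it — at every finite place `v` of `ℚ`, for
every prime `p`, with NO reduction / image hypothesis — from Tate's local Euler–Poincaré
characteristic `hEP : localEulerPoincareCharacteristic ℚ_v` (Milne I Thm. 2.8; the named fact the
consumers ALREADY carry) alone, in the sibling `PropagatedConditionCard.lean`.  This file is the
COUNTING half, entirely inside the ONE group `X = H¹(ℚ_v, E(ℚ̄_v))` (no `H²(ℚ_v, T_pE)`, no
`lim`-comparison, no functorial duality):

* `natCard_torsionBy_localGaloisModule_pow` : `#X[p^k] = #E(ℚ_v)[p^k] · #(𝓞_v/p^k)` for every `k`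
  (Milne I Thm. 3.2 + Lemma 3.3 from `hEP`, tree
  `natCard_torsionBy_galoisCohomology_localGaloisModule_eq_of_localEuler`; its `H²` input is the
  tree THEOREM `natCard_galoisCohomology_two_torsion_restrictField`);
* `natCard_map_pow_smul_torsionBy_mul` : with `D_N := p^N • X[p^{N+1}]`,
  `#D_N · #E(ℚ_v)[p^N] · #(𝓞_v/p^N) = #E(ℚ_v)[p^{N+1}] · #(𝓞_v/p^N) · #(𝓞_v/p)`
  (`#X[p^{N+1}] = #X[p^N] · #D_N`, first isomorphism theorem `natCard_torsionBy_mul_eq`, and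
  `#(𝓞_v/p^{N+1}) = #(𝓞_v/p^N) · #(𝓞_v/p)`);
* `exists_forall_natCard_ker_nsmul_pow_succ_eq` : `#E(ℚ_v)[p^N]` is non-decreasing and bounded
  (n1011-p05 `exists_natCard_ker_nsmul_adicCompletion_le`, Silverman VII.6.3), hence eventually
  constant;
* `map_pow_smul_torsionBy_succ_le` : `D_{N+1} ≤ D_N`;
* `exists_level_map_pow_smul_torsionBy_stable` : **there is `N₀` with `D_N = D_{N₀}` for all
  `N ≥ N₀`, `D_{N₀} ≤ D_N` for all `N`, and `#D_{N₀} = #(𝓞_v/p)`**.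

References: R. Greenberg, LNM 1716 (1999) §2; J. S. Milne, *ADT* I Thm. 2.8, Thm. 3.2, Lemma 3.3
[MilneADT2006]; J. H. Silverman, *AEC* VII.6.3, X.§4 [SilvermanAEC2009].
-/

noncomputable section

open scoped Classical NumberField ContRepresentation
open Field NumberField IsDedekindDomain Function
open WeierstrassCurve Literature.NumberTheory.EllipticCurves Literature.NumberTheory.GaloisRepresentations
  Literature.NumberTheory.GaloisRepresentations.DiscreteGaloisModule

namespace Summit.BirchSwinnertonDyer.Rank1Residual.GaloisImage

/-! ### Three counting lemmas -/

section Counting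

/-- `#(R ⧸ (ab)) = #(R ⧸ (a)) · #(R ⧸ (b))` for `a ≠ 0` in a domain (the exact sequence
`0 → R/(b) →ᵃ R/(ab) → R/(a) → 0`; the tree's `LocalEulerCharacteristicTorsion` has the same lemma
privately). [folklore] -/
theorem natCard_quotient_span_singleton_mul' {R : Type*} [CommRing R] [IsDomain R] {a : R}
    (ha : a ≠ 0) (b : R) :
    Nat.card (R ⧸ Ideal.span {a * b}) =
      Nat.card (R ⧸ Ideal.span {a}) * Nat.card (R ⧸ Ideal.span {b}) := by
  have hle : Ideal.span {a * b} ≤ Ideal.span {a} := Ideal.span_singleton_le_span_singleton.mpr ⟨b, rfl⟩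
  let f : R ⧸ Ideal.span {a * b} →+* R ⧸ Ideal.span {a} := Ideal.Quotient.factor hle
  have hf : Surjective f := Ideal.Quotient.factor_surjective hle
  let g : R →+ R ⧸ Ideal.span {a * b} :=
    (Ideal.Quotient.mk (Ideal.span {a * b})).toAddMonoidHom.comp (AddMonoidHom.mulLeft a)
  have hgker : g.ker = (Ideal.span {b}).toAddSubgroup := by
    ext x
    simp only [g, AddMonoidHom.mem_ker, AddMonoidHom.coe_comp, comp_apply, AddMonoidHom.coe_mulLeft,
      RingHom.toAddMonoidHom_eq_coe, AddMonoidHom.coe_coe, Ideal.Quotient.eq_zero_iff_mem,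
      Ideal.mem_span_singleton, Submodule.mem_toAddSubgroup]
    constructor
    · rintro ⟨c, hc⟩
      exact ⟨c, mul_left_cancel₀ ha (by rw [hc, mul_assoc])⟩
    · rintro ⟨c, rfl⟩
      exact ⟨c, by rw [mul_assoc]⟩
  have hgrange : g.range = f.toAddMonoidHom.ker := by
    ext y
    constructor
    · rintro ⟨x, rfl⟩
      simp only [g, f, RingHom.toAddMonoidHom_eq_coe, AddMonoidHom.mem_ker, AddMonoidHom.coe_comp,
        AddMonoidHom.coe_coe, comp_apply, AddMonoidHom.coe_mulLeft, Ideal.Quotient.factor_mk,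
        Ideal.Quotient.eq_zero_iff_mem]
      exact Ideal.mem_span_singleton.mpr ⟨x, rfl⟩
    · intro hy
      obtain ⟨z, rfl⟩ := Ideal.Quotient.mk_surjective y
      simp only [f, RingHom.toAddMonoidHom_eq_coe, AddMonoidHom.mem_ker, AddMonoidHom.coe_coe,
        Ideal.Quotient.factor_mk, Ideal.Quotient.eq_zero_iff_mem, Ideal.mem_span_singleton] at hy
      obtain ⟨c, rfl⟩ := hy
      exact ⟨c, rfl⟩
  -- `#(R/(ab)) = #(R/(a)) · #ker f` and `#ker f = #range g = #(R/ker g) = #(R/(b))`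
  have h1 := AddSubgroup.card_eq_card_quotient_mul_card_addSubgroup f.toAddMonoidHom.ker
  have h2 : Nat.card ((R ⧸ Ideal.span {a * b}) ⧸ f.toAddMonoidHom.ker) = Nat.card (R ⧸ Ideal.span {a}) :=
    Nat.card_congr (QuotientAddGroup.quotientKerEquivOfSurjective f.toAddMonoidHom hf).toEquiv
  have h3 : Nat.card f.toAddMonoidHom.ker = Nat.card (R ⧸ Ideal.span {b}) := by
    rw [← hgrange, ← Nat.card_congr (QuotientAddGroup.quotientKerEquivRange g).toEquiv, hgker]
    rfl
  rw [h1, h2, h3]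

/-- **`#A[m·b] = #A[m] · #(m • A[m·b])`** for an abelian group `A` with `A[m·b]` finite: the first
isomorphism theorem for multiplication by `m` on `A[m·b]`, whose kernel is `A[m]`. [folklore] -/
theorem natCard_torsionBy_mul_eq {A : Type*} [AddCommGroup A] (m b : ℕ)
    [Finite (AddSubgroup.torsionBy A ((m * b : ℕ) : ℤ))] :
    Nat.card (AddSubgroup.torsionBy A ((m * b : ℕ) : ℤ)) =
      Nat.card (AddSubgroup.torsionBy A (m : ℤ)) *
        Nat.card ((AddSubgroup.torsionBy A ((m * b : ℕ) : ℤ)).map (zsmulAddGroupHom (m : ℤ))) := by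
  set T := AddSubgroup.torsionBy A ((m * b : ℕ) : ℤ) with hT
  have hmem : ∀ {n : ℤ} {x : A}, x ∈ AddSubgroup.torsionBy A n ↔ n • x = 0 :=
    fun {n} {x} => Submodule.mem_torsionBy_iff n x
  have hle : AddSubgroup.torsionBy A (m : ℤ) ≤ T := by
    intro x hx
    rw [hmem] at hx ⊢
    rw [Nat.cast_mul, mul_comm, mul_smul, hx, smul_zero]
  let ψ : T →+ A := (zsmulAddGroupHom (m : ℤ)).comp T.subtype
  have hrange : ψ.range = T.map (zsmulAddGroupHom (m : ℤ)) := by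
    rw [AddMonoidHom.range_comp, AddSubgroup.range_subtype]
  have hker : ψ.ker = (AddSubgroup.torsionBy A (m : ℤ)).addSubgroupOf T := by
    ext t
    rw [AddMonoidHom.mem_ker, AddSubgroup.mem_addSubgroupOf, hmem]
    rfl
  rw [AddSubgroup.card_eq_card_quotient_mul_card_addSubgroup ψ.ker,
    Nat.card_congr (QuotientAddGroup.quotientKerEquivRange ψ).toEquiv, hrange, hker,
    Nat.card_congr (AddSubgroup.addSubgroupOfEquivOfLe hle).toEquiv, mul_comm]

/-- A non-decreasing bounded sequence of natural numbers is eventually constant. [folklore] -/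
theorem exists_forall_le_eq_of_monotone_of_le (t : ℕ → ℕ) (ht : Monotone t) {B : ℕ}
    (hB : ∀ n, t n ≤ B) : ∃ N₀ : ℕ, ∀ N, N₀ ≤ N → t N = t N₀ := by
  have hbdd : BddAbove (Set.range t) := ⟨B, by rintro _ ⟨n, rfl⟩; exact hB n⟩
  obtain ⟨N₀, hN₀⟩ : sSup (Set.range t) ∈ Set.range t := Nat.sSup_mem ⟨t 0, 0, rfl⟩ hbdd
  refine ⟨N₀, fun N hN => le_antisymm ?_ (ht hN)⟩
  rw [hN₀]
  exact le_csSup hbdd ⟨N, rfl⟩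

end Counting

/-! ### The place `(p)` of `ℚ` -/

section PlaceP

variable (p : ℕ) [hp : Fact p.Prime]

/-- `#(ℤ_p / p ℤ_p) = p` at the place `(p)` of `ℚ` (`∏_{v ∣ p} #(𝓞_v/p) = p^{[ℚ:ℚ]}`, tree
`prod_natCard_quot_adicCompletionIntegers`; `ℚ` has one place above `p`, cf. the tree's
`X2.TrivialZeroQuotient.eq_of_natCast_mem`). [folklore] -/
theorem natCard_quot_adicCompletionIntegers_of_prime_mem {v : HeightOneSpectrum (𝓞 ℚ)}
    (hv : ((p : ℕ) : 𝓞 ℚ) ∈ v.asIdeal) :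
    Nat.card (v.adicCompletionIntegers ℚ ⧸ Ideal.span {((p : ℕ) : v.adicCompletionIntegers ℚ)}) = p := by
  -- one place above `p`
  have huniq : ∀ w : HeightOneSpectrum (𝓞 ℚ), ((p : ℕ) : 𝓞 ℚ) ∈ w.asIdeal → w = v := fun w hw =>
    HeightOneSpectrum.ext (by
      rw [Rat.asIdeal_eq_span_of_prime_mem w hp.out hw, Rat.asIdeal_eq_span_of_prime_mem v hp.out hv])
  have h := prod_natCard_quot_adicCompletionIntegers (K := ℚ) (p := p) {v} (fun w hw hpw =>
    hw (Finset.mem_singleton.mpr (huniq w hpw)))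
  rwa [Finset.prod_singleton, Module.finrank_self, pow_one] at h

end PlaceP

variable (W : WeierstrassCurve ℚ) [W.IsElliptic] (p : ℕ) [hp : Fact p.Prime]
  (v : HeightOneSpectrum (𝓞 ℚ))

/-! ### S5. Orders in `X = H¹(ℚ_v, E(ℚ̄_v))` from `hEP` -/

/-- **`#X[p^k] = #E(ℚ_v)[p^k] · #(𝓞_v/p^k)`** for every `k` (including `k = 0`), `X = H¹(ℚ_v, E(ℚ̄_v))`:
Milne I Thm. 3.2 + Lemma 3.3 from Tate's local Euler–Poincaré characteristic (tree
`natCard_torsionBy_galoisCohomology_localGaloisModule_eq_of_localEuler`), in the spelling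
`Place.Completion (Sum.inr v)` of the Selmer-structure files. [cite: MilneADT2006, Ch. I, Thm. 3.2 and Lemma 3.3] -/
theorem natCard_torsionBy_localGaloisModule_pow
    (hEP : localEulerPoincareCharacteristic (v.adicCompletion ℚ)) (k : ℕ) :
    Nat.card (AddSubgroup.torsionBy
        (galoisCohomology (W.localGaloisModule (Place.Completion (Sum.inr v : Place ℚ))) 1)
        ((p ^ k : ℕ) : ℤ)) =
      Nat.card (nsmulAddMonoidHom (p ^ k) : (W.baseChange (v.adicCompletion ℚ)).toAffine.Point →+ _).ker *
        Nat.card (v.adicCompletionIntegers ℚ ⧸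
          Ideal.span {((p ^ k : ℕ) : v.adicCompletionIntegers ℚ)}) := by
  cases k with
  | zero =>
    -- `X[1] = 0`, `E(ℚ_v)[1] = 0`, `𝓞_v/1 = 0`
    have h1 : Nat.card (AddSubgroup.torsionBy
        (galoisCohomology (W.localGaloisModule (Place.Completion (Sum.inr v : Place ℚ))) 1)
        ((p ^ 0 : ℕ) : ℤ)) = 1 := by
      rw [Nat.card_eq_one_iff_unique]
      have key : ∀ z : galoisCohomology (W.localGaloisModule (Place.Completion (Sum.inr v : Place ℚ))) 1,
          ((p ^ 0 : ℕ) : ℤ) • z = 0 → z = 0 := fun z hz => by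
        simpa only [pow_zero, Nat.cast_one, one_smul] using hz
      refine ⟨⟨fun x y => Subtype.ext ?_⟩, ⟨0⟩⟩
      rw [key _ ((Submodule.mem_torsionBy_iff _ _).mp x.2),
        key _ ((Submodule.mem_torsionBy_iff _ _).mp y.2)]
    have h2 : Nat.card (nsmulAddMonoidHom (p ^ 0) :
        (W.baseChange (v.adicCompletion ℚ)).toAffine.Point →+ _).ker = 1 := by
      rw [Nat.card_eq_one_iff_unique]
      have key : ∀ z : (W.baseChange (v.adicCompletion ℚ)).toAffine.Point,
          nsmulAddMonoidHom (p ^ 0) z = 0 → z = 0 := fun z hz => by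
        simpa only [nsmulAddMonoidHom_apply, pow_zero, one_smul] using hz
      refine ⟨⟨fun x y => Subtype.ext ?_⟩, ⟨0⟩⟩
      rw [key _ ((AddMonoidHom.mem_ker).mp x.2), key _ ((AddMonoidHom.mem_ker).mp y.2)]
    have h3 : Nat.card (v.adicCompletionIntegers ℚ ⧸
        Ideal.span {((p ^ 0 : ℕ) : v.adicCompletionIntegers ℚ)}) = 1 := by
      rw [pow_zero, Nat.cast_one, Ideal.span_singleton_one]
      haveI : Subsingleton (v.adicCompletionIntegers ℚ ⧸ (⊤ : Ideal (v.adicCompletionIntegers ℚ))) :=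
        Ideal.Quotient.subsingleton_iff.mpr rfl
      exact Nat.card_of_subsingleton (0 : v.adicCompletionIntegers ℚ ⧸ (⊤ : Ideal _))
    rw [h1, h2, h3]
  | succ k =>
    haveI : NeZero (p ^ (k + 1)) := ⟨pow_ne_zero _ hp.out.ne_zero⟩
    exact natCard_torsionBy_galoisCohomology_localGaloisModule_eq_of_localEuler W v (p ^ (k + 1))
      (hp.out.isPrimePow.pow (Nat.succ_ne_zero k)) hEP

/-- `X[p^k]` is finite (its order is a product of orders of finite non-empty groups). [folklore] -/
theorem finite_torsionBy_localGaloisModule_pow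
    (hEP : localEulerPoincareCharacteristic (v.adicCompletion ℚ)) (k : ℕ) :
    Finite (AddSubgroup.torsionBy
        (galoisCohomology (W.localGaloisModule (Place.Completion (Sum.inr v : Place ℚ))) 1)
        ((p ^ k : ℕ) : ℤ)) := by
  refine Nat.finite_of_card_ne_zero ?_
  rw [natCard_torsionBy_localGaloisModule_pow W p v hEP k]
  haveI := W.finite_ker_nsmul_adicCompletion v (pow_ne_zero k hp.out.ne_zero)
  exact mul_ne_zero Nat.card_pos.ne' (LocalPoints.card_quotient_span_natCast_ne_zero v
    (pow_ne_zero k hp.out.ne_zero))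

/-- **`#D_N · #E(ℚ_v)[p^N] · #(𝓞_v/p^N) = #E(ℚ_v)[p^{N+1}] · #(𝓞_v/p^N) · #(𝓞_v/p)`** for
`D_N = p^N • X[p^{N+1}]`: `#X[p^{N+1}] = #X[p^N] · #D_N` (`natCard_torsionBy_mul_eq`) with the two
orders from `hEP` and `#(𝓞_v/p^{N+1}) = #(𝓞_v/p^N) · #(𝓞_v/p)`. [cite: MilneADT2006, Ch. I, Thm. 3.2 and Lemma 3.3] -/
theorem natCard_map_pow_smul_torsionBy_mul
    (hEP : localEulerPoincareCharacteristic (v.adicCompletion ℚ)) (N : ℕ) :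
    Nat.card ((AddSubgroup.torsionBy
        (galoisCohomology (W.localGaloisModule (Place.Completion (Sum.inr v : Place ℚ))) 1)
        ((p ^ (N + 1) : ℕ) : ℤ)).map (zsmulAddGroupHom ((p ^ N : ℕ) : ℤ))) *
      (Nat.card (nsmulAddMonoidHom (p ^ N) : (W.baseChange (v.adicCompletion ℚ)).toAffine.Point →+ _).ker *
        Nat.card (v.adicCompletionIntegers ℚ ⧸
          Ideal.span {((p ^ N : ℕ) : v.adicCompletionIntegers ℚ)})) =
      Nat.card (nsmulAddMonoidHom (p ^ (N + 1)) :
          (W.baseChange (v.adicCompletion ℚ)).toAffine.Point →+ _).ker *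
        (Nat.card (v.adicCompletionIntegers ℚ ⧸
            Ideal.span {((p ^ N : ℕ) : v.adicCompletionIntegers ℚ)}) *
          Nat.card (v.adicCompletionIntegers ℚ ⧸
            Ideal.span {((p : ℕ) : v.adicCompletionIntegers ℚ)})) := by
  haveI := finite_torsionBy_localGaloisModule_pow W p v hEP (N + 1)
  have hsucc := natCard_torsionBy_localGaloisModule_pow W p v hEP (N + 1)
  have hN := natCard_torsionBy_localGaloisModule_pow W p v hEP N
  -- `#(𝓞_v/p^{N+1}) = #(𝓞_v/p^N) · #(𝓞_v/p)`
  have hq : Nat.card (v.adicCompletionIntegers ℚ ⧸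
      Ideal.span {((p ^ (N + 1) : ℕ) : v.adicCompletionIntegers ℚ)}) =
      Nat.card (v.adicCompletionIntegers ℚ ⧸ Ideal.span {((p ^ N : ℕ) : v.adicCompletionIntegers ℚ)}) *
        Nat.card (v.adicCompletionIntegers ℚ ⧸ Ideal.span {((p : ℕ) : v.adicCompletionIntegers ℚ)}) := by
    rw [← natCard_quotient_span_singleton_mul' (LocalPoints.natCast_ne_zero v
      (pow_ne_zero N hp.out.ne_zero)), ← Nat.cast_mul, ← pow_succ]
  -- `#X[p^{N+1}] = #X[p^N] · #D_N` (the level `p^{N+1}` spelled `p^N · p` for the kernel)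
  haveI : Finite (AddSubgroup.torsionBy
      (galoisCohomology (W.localGaloisModule (Place.Completion (Sum.inr v : Place ℚ))) 1)
      ((p ^ N * p : ℕ) : ℤ)) := by rw [← pow_succ]; infer_instance
  have hsplit := natCard_torsionBy_mul_eq
    (A := galoisCohomology (W.localGaloisModule (Place.Completion (Sum.inr v : Place ℚ))) 1) (p ^ N) p
  rw [← pow_succ] at hsplit
  rw [hsplit, hN, hq] at hsucc
  -- hsucc : tN·qN·#D = t_{N+1}·(qN·q)
  calc _ = Nat.card (nsmulAddMonoidHom (p ^ N) :
            (W.baseChange (v.adicCompletion ℚ)).toAffine.Point →+ _).ker *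
          Nat.card (v.adicCompletionIntegers ℚ ⧸ Ideal.span {((p ^ N : ℕ) : v.adicCompletionIntegers ℚ)}) *
          Nat.card ((AddSubgroup.torsionBy
            (galoisCohomology (W.localGaloisModule (Place.Completion (Sum.inr v : Place ℚ))) 1)
            ((p ^ (N + 1) : ℕ) : ℤ)).map (zsmulAddGroupHom ((p ^ N : ℕ) : ℤ))) := by ring
    _ = _ := hsucc


/-! ### S6. Stabilisation of `#E(ℚ_v)[p^N]` and of the subgroups `D_N = p^N • X[p^{N+1}]` -/

omit hp in
/-- **`#E(ℚ_v)[p^N]` is eventually constant**: it is non-decreasing in `N` (`E(ℚ_v)[p^N] ≤ E(ℚ_v)[p^{N+1}]`)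
and bounded (n1011-p05 `exists_natCard_ker_nsmul_adicCompletion_le`: `E(ℚ_v)` has a torsion-free
subgroup of finite index, Silverman VII.6.3). [cite: SilvermanAEC2009, Prop. VII.6.3] -/
theorem exists_forall_natCard_ker_nsmul_pow_succ_eq (hp0 : p ≠ 0) :
    ∃ N₀ : ℕ, ∀ N, N₀ ≤ N →
      Nat.card (nsmulAddMonoidHom (p ^ (N + 1)) :
          (W.baseChange (v.adicCompletion ℚ)).toAffine.Point →+ _).ker =
        Nat.card (nsmulAddMonoidHom (p ^ N) :
          (W.baseChange (v.adicCompletion ℚ)).toAffine.Point →+ _).ker := by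
  let t : ℕ → ℕ := fun k =>
    Nat.card (nsmulAddMonoidHom (p ^ k) : (W.baseChange (v.adicCompletion ℚ)).toAffine.Point →+ _).ker
  have hmono : Monotone t := by
    refine monotone_nat_of_le_succ fun k => ?_
    haveI := W.finite_ker_nsmul_adicCompletion v (pow_ne_zero (k + 1) hp0)
    refine AddSubgroup.card_le_of_le fun x hx => ?_
    rw [AddMonoidHom.mem_ker, nsmulAddMonoidHom_apply] at hx ⊢
    rw [pow_succ', mul_smul, hx, smul_zero]
  obtain ⟨B, -, hB⟩ := exists_natCard_ker_nsmul_adicCompletion_le W v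
  obtain ⟨N₀, hN₀⟩ := exists_forall_le_eq_of_monotone_of_le t hmono
    (B := B) (fun k => hB _ (pow_ne_zero k hp0))
  exact ⟨N₀, fun N hN => (hN₀ (N + 1) (hN.trans (Nat.le_succ N))).trans (hN₀ N hN).symm⟩

omit [W.IsElliptic] hp in
/-- **`D_{N+1} ≤ D_N`** (`D_N = p^N • X[p^{N+1}]`): `p^{N+1} • c = p^N • (p • c)` and
`p • c ∈ X[p^{N+1}]` for `c ∈ X[p^{N+2}]`. [folklore] -/
theorem map_pow_smul_torsionBy_succ_le (N : ℕ) :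
    (AddSubgroup.torsionBy
        (galoisCohomology (W.localGaloisModule (Place.Completion (Sum.inr v : Place ℚ))) 1)
        ((p ^ (N + 2) : ℕ) : ℤ)).map (zsmulAddGroupHom ((p ^ (N + 1) : ℕ) : ℤ)) ≤
      (AddSubgroup.torsionBy
        (galoisCohomology (W.localGaloisModule (Place.Completion (Sum.inr v : Place ℚ))) 1)
        ((p ^ (N + 1) : ℕ) : ℤ)).map (zsmulAddGroupHom ((p ^ N : ℕ) : ℤ)) := by
  rintro _ ⟨c, hc, rfl⟩
  have hc' : ((p ^ (N + 2) : ℕ) : ℤ) • c = 0 := (Submodule.mem_torsionBy_iff _ _).mp hc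
  refine ⟨(p : ℤ) • c, ?_, ?_⟩
  · show _ ∈ AddSubgroup.torsionBy _ _
    rw [AddSubgroup.torsionBy, Submodule.mem_toAddSubgroup, Submodule.mem_torsionBy_iff]
    change ((p ^ (N + 1) : ℕ) : ℤ) • (p : ℤ) • c = 0
    rw [smul_smul, ← Nat.cast_mul, ← pow_succ]
    exact hc'
  · rw [zsmulAddGroupHom_apply, zsmulAddGroupHom_apply, smul_smul, ← Nat.cast_mul, ← pow_succ]

/-- **Stabilisation of `D_N = p^N • X[p^{N+1}]`**: there is a level `N₀` with `D_N = D_{N₀}` for all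
`N ≥ N₀`, `D_{N₀} ≤ D_N` for all `N`, and `#D_{N₀} = #(𝓞_v/p)` — from
`#D_N · #E(ℚ_v)[p^N] · #(𝓞_v/p^N) = #E(ℚ_v)[p^{N+1}] · #(𝓞_v/p^N) · #(𝓞_v/p)`, the stabilisation of
`#E(ℚ_v)[p^N]`, and the decrease of the `D_N`. [cite: MilneADT2006, Ch. I, Thm. 3.2 and Lemma 3.3] -/
theorem exists_level_map_pow_smul_torsionBy_stable
    (hEP : localEulerPoincareCharacteristic (v.adicCompletion ℚ)) :
    ∃ N₀ : ℕ,
      (∀ N, N₀ ≤ N →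
        (AddSubgroup.torsionBy
          (galoisCohomology (W.localGaloisModule (Place.Completion (Sum.inr v : Place ℚ))) 1)
          ((p ^ (N + 1) : ℕ) : ℤ)).map (zsmulAddGroupHom ((p ^ N : ℕ) : ℤ)) =
        (AddSubgroup.torsionBy
          (galoisCohomology (W.localGaloisModule (Place.Completion (Sum.inr v : Place ℚ))) 1)
          ((p ^ (N₀ + 1) : ℕ) : ℤ)).map (zsmulAddGroupHom ((p ^ N₀ : ℕ) : ℤ))) ∧
      (∀ N,
        (AddSubgroup.torsionBy
          (galoisCohomology (W.localGaloisModule (Place.Completion (Sum.inr v : Place ℚ))) 1)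
          ((p ^ (N₀ + 1) : ℕ) : ℤ)).map (zsmulAddGroupHom ((p ^ N₀ : ℕ) : ℤ)) ≤
        (AddSubgroup.torsionBy
          (galoisCohomology (W.localGaloisModule (Place.Completion (Sum.inr v : Place ℚ))) 1)
          ((p ^ (N + 1) : ℕ) : ℤ)).map (zsmulAddGroupHom ((p ^ N : ℕ) : ℤ))) ∧
      Nat.card ((AddSubgroup.torsionBy
          (galoisCohomology (W.localGaloisModule (Place.Completion (Sum.inr v : Place ℚ))) 1)
          ((p ^ (N₀ + 1) : ℕ) : ℤ)).map (zsmulAddGroupHom ((p ^ N₀ : ℕ) : ℤ))) =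
        Nat.card (v.adicCompletionIntegers ℚ ⧸
          Ideal.span {((p : ℕ) : v.adicCompletionIntegers ℚ)}) := by
  -- notation
  let X := galoisCohomology (W.localGaloisModule (Place.Completion (Sum.inr v : Place ℚ))) 1
  let D : ℕ → AddSubgroup X := fun N =>
    (AddSubgroup.torsionBy X ((p ^ (N + 1) : ℕ) : ℤ)).map (zsmulAddGroupHom ((p ^ N : ℕ) : ℤ))
  let t : ℕ → ℕ := fun k =>
    Nat.card (nsmulAddMonoidHom (p ^ k) : (W.baseChange (v.adicCompletion ℚ)).toAffine.Point →+ _).ker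
  let q : ℕ := Nat.card (v.adicCompletionIntegers ℚ ⧸
    Ideal.span {((p : ℕ) : v.adicCompletionIntegers ℚ)})
  have hq0 : q ≠ 0 := LocalPoints.card_quotient_span_natCast_ne_zero v hp.out.ne_zero
  -- the `D_N` decrease
  have hanti : Antitone D := antitone_nat_of_succ_le fun N => map_pow_smul_torsionBy_succ_le W p v N
  -- `#D_N = q` for `N ≥ N₀`
  obtain ⟨N₀, hN₀⟩ := exists_forall_natCard_ker_nsmul_pow_succ_eq W p v hp.out.ne_zero
  have hcard : ∀ N, N₀ ≤ N → Nat.card (D N) = q := by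
    intro N hN
    have h := natCard_map_pow_smul_torsionBy_mul W p v hEP N
    have ht : t (N + 1) = t N := hN₀ N hN
    change Nat.card (D N) * (t N * _) = t (N + 1) * _ at h
    rw [ht] at h
    have hpos : 0 < t N * Nat.card (v.adicCompletionIntegers ℚ ⧸
        Ideal.span {((p ^ N : ℕ) : v.adicCompletionIntegers ℚ)}) := by
      haveI := W.finite_ker_nsmul_adicCompletion v (pow_ne_zero N hp.out.ne_zero)
      exact Nat.pos_of_ne_zero (mul_ne_zero Nat.card_pos.ne'
        (LocalPoints.card_quotient_span_natCast_ne_zero v (pow_ne_zero N hp.out.ne_zero)))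
    apply Nat.eq_of_mul_eq_mul_right hpos
    rw [h]
    ring
  -- `D_N = D_{N₀}` for `N ≥ N₀`
  have hfin : Finite (D N₀) := Nat.finite_of_card_ne_zero (by rw [hcard N₀ le_rfl]; exact hq0)
  have heq : ∀ N, N₀ ≤ N → D N = D N₀ := fun N hN =>
    AddSubgroup.eq_of_le_of_card_ge (hanti hN) (by rw [hcard N hN, hcard N₀ le_rfl])
  refine ⟨N₀, heq, fun N => ?_, hcard N₀ le_rfl⟩
  rcases le_total N₀ N with hN | hN
  · exact (heq N hN).ge
  · exact hanti hN

end Summit.BirchSwinnertonDyer.Rank1Residual.GaloisImage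

end
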